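import Summits.CriticalPhenomena.PercolationContinuityZ3.Theorems.PercAnnulusCrossingIICIntrinsicVolumeExponent
import HarnessLib

/-!
# The intrinsic-ball rate constants of Kesten's IIC are trivial off the critical power scales (lane RSW3, p1 gen 14)

builds on p205010 (kernel theorem, internal audit signed; external expert review pending) — only through the imported gen 14 files.

Seat `prim-rsw3-p1` (gen 14); memo `run/shared/lean/prim/rsw3/P1-QM.md` §27.  Helper file for the crux `stmt-CriticalPhenomena-4575`
chain; no definitions, no sorries.

For the intrinsic-ball volume `I_r` gen 14's ADDITIVE engine does not give a.s.-constant rates `I_r/σ_r` (only a shifted sandwich is available),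
but the deterministic EXPONENTS `γ^±` (`…IICIntrinsicVolumeExponent`) and the generic exponent/scale lemmas (`…IICExponentPhaseDiagram`) still
decide every non-critical power scale:

* **`iicMeasure_intrinsic_rate_phase_diagram`** (`θ(p) = 0`, (A2)□, `2 ≤ s`) — for every `α > 0`: `ν`-a.s. `limsup_r I_r/(r+2)^α = 0` if `γ⁺ < α`,
  `= ∞` if `α < γ⁺`; `liminf_r I_r/(r+2)^α = 0` if `γ⁻ < α`, `= ∞` if `α < γ⁻` — so the intrinsic rate constants ARE a.s. constant (and trivial)
  at every power scale except possibly the critical ones.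

References: H. Kesten, PTRF 73 (1986); H.-O. Georgii (2011), Prop. 7.9.
-/

noncomputable section

namespace Summit.CriticalPhenomena.PercolationContinuityZ3.Theorems.Crossing

open MeasureTheory Filter Topology Literature.Probability.Percolation Literature.Probability.LatticeModels
open Literature.Probability.Percolation.DCT16 Literature.Probability.Percolation.DKT20
open Summit.CriticalPhenomena.PercolationContinuityZ3.Theorems.SurfaceTension
open scoped Literature.Probability.Percolation ENNReal symmDiff

variable {d : ℕ}

/-- **THE INTRINSIC-RATE PHASE DIAGRAM OF KESTEN'S IIC** (`θ(p) = 0`, (A2)□ at aspect `(s,L)`, `2 ≤ s`): with the deterministic intrinsic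
exponents `γ⁻ ≤ γ⁺`, for every power scale `α > 0`: `ν`-a.s. `limsup_r I_r/(r+2)^α = 0` if `γ⁺ < α`, `= ∞` if `α < γ⁺`; `liminf_r I_r/(r+2)^α = 0`
if `γ⁻ < α`, `= ∞` if `α < γ⁻`. [cite: Kesten1986, Thm. (3)] [cite: Georgii2011, Prop. 7.9] -/
theorem iicMeasure_intrinsic_rate_phase_diagram (hd : 1 ≤ d) (p : unitInterval) (hp : 0 < (p : ℝ))
    (hθ : theta (zdGraph d) 0 p = 0) {s L : ℕ} (hs : 2 ≤ s) {ϰ : ℝ} (hϰ : 0 < ϰ) (hA2 : SetToSetQuasiMultAspectAt d p s L ϰ)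
    {ν : Measure (BondConfig (Site d))} [IsProbabilityMeasure ν]
    (hν : ∀ (F : Finset (Sym2 (Site d))) (E : Set (BondConfig (Site d))), MeasurableSet E → DeterminedBy E ↑F →
      Tendsto (fun n : ℕ => (bondPercolation (zdGraph d) p).real (E ∩ siteToBoundary d n) / oneArmProb d p n)
        atTop (𝓝 (ν.real E))) :
    ∃ γl γu : ℝ≥0∞, (∀ᵐ ω ∂ν,
      liminf (fun r => ENNReal.ofReal (Real.log
        ((Set.ncard {z : Site d | z ∈ box d r ∧ (openGraph ω).edist (0 : Site d) z ≤ (r : ℕ)} : ℕ) : ℝ) /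
          Real.log ((r : ℝ) + 2))) atTop = γl ∧
      limsup (fun r => ENNReal.ofReal (Real.log
        ((Set.ncard {z : Site d | z ∈ box d r ∧ (openGraph ω).edist (0 : Site d) z ≤ (r : ℕ)} : ℕ) : ℝ) /
          Real.log ((r : ℝ) + 2))) atTop = γu) ∧
    ∀ α : ℝ, 0 < α →
      (γu < ENNReal.ofReal α → ∀ᵐ ω ∂ν, limsup (fun r => ENNReal.ofReal
        (((Set.ncard {z : Site d | z ∈ box d r ∧ (openGraph ω).edist (0 : Site d) z ≤ (r : ℕ)} : ℕ) : ℝ) /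
          ((r : ℝ) + 2) ^ α)) atTop = 0) ∧
      (ENNReal.ofReal α < γu → ∀ᵐ ω ∂ν, limsup (fun r => ENNReal.ofReal
        (((Set.ncard {z : Site d | z ∈ box d r ∧ (openGraph ω).edist (0 : Site d) z ≤ (r : ℕ)} : ℕ) : ℝ) /
          ((r : ℝ) + 2) ^ α)) atTop = ⊤) ∧
      (γl < ENNReal.ofReal α → ∀ᵐ ω ∂ν, liminf (fun r => ENNReal.ofReal
        (((Set.ncard {z : Site d | z ∈ box d r ∧ (openGraph ω).edist (0 : Site d) z ≤ (r : ℕ)} : ℕ) : ℝ) /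
          ((r : ℝ) + 2) ^ α)) atTop = 0) ∧
      (ENNReal.ofReal α < γl → ∀ᵐ ω ∂ν, liminf (fun r => ENNReal.ofReal
        (((Set.ncard {z : Site d | z ∈ box d r ∧ (openGraph ω).edist (0 : Site d) z ≤ (r : ℕ)} : ℕ) : ℝ) /
          ((r : ℝ) + 2) ^ α)) atTop = ⊤) := by
  obtain ⟨⟨γu, hu⟩, γl, hl⟩ := iicMeasure_exists_ae_intrinsic_volume_exponents_eq_const hd p hp hθ hs hϰ hA2 hν
  refine ⟨γl, γu, ?_, fun α hα => ⟨fun h => ?_, fun h => ?_, fun h => ?_, fun h => ?_⟩⟩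
  · filter_upwards [hl, hu] with ω h1 h2; exact ⟨h1, h2⟩
  · filter_upwards [hu] with ω hω
    exact limsup_div_rpow_eq_zero_of_limsup_log_lt
      (fun r => Set.ncard {z : Site d | z ∈ box d r ∧ (openGraph ω).edist (0 : Site d) z ≤ (r : ℕ)}) (hω.symm ▸ h)
  · filter_upwards [hu] with ω hω
    exact limsup_div_rpow_eq_top_of_lt_limsup_log
      (fun r => Set.ncard {z : Site d | z ∈ box d r ∧ (openGraph ω).edist (0 : Site d) z ≤ (r : ℕ)}) hα (hω.symm ▸ h)
  · filter_upwards [hl] with ω hω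
    exact liminf_div_rpow_eq_zero_of_liminf_log_lt
      (fun r => Set.ncard {z : Site d | z ∈ box d r ∧ (openGraph ω).edist (0 : Site d) z ≤ (r : ℕ)}) (hω.symm ▸ h)
  · filter_upwards [hl] with ω hω
    exact liminf_div_rpow_eq_top_of_lt_liminf_log
      (fun r => Set.ncard {z : Site d | z ∈ box d r ∧ (openGraph ω).edist (0 : Site d) z ≤ (r : ℕ)}) hα (hω.symm ▸ h)

end Summit.CriticalPhenomena.PercolationContinuityZ3.Theorems.Crossing

end
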